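import Literature.NumberTheory.EllipticCurves.SteinWuthrich2013.MultiplicativeLeadingTerm
import Literature.NumberTheory.EllipticCurves.TateCurve.UniformizationPoints
import Literature.NumberTheory.EllipticCurves.TateCurve.UniformizationSurjective
import Literature.NumberTheory.EllipticCurves.TateCurve.UniformizationFormalGroup
import Literature.NumberTheory.EllipticCurves.TateCurve.UniformizationResidueUnits
import Literature.NumberTheory.EllipticCurves.TateCurve.UniformizationUnitEstimates
import Literature.NumberTheory.EllipticCurves.TateCurve.TateFormalAdditionIdentity
import Literature.NumberTheory.EllipticCurves.CanonicalPAdicHeightThetaProofs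
import Literature.NumberTheory.EllipticCurves.VariableChangePoints
import Literature.NumberTheory.EllipticCurves.FormalGroupLawPadicProofs
import Literature.NumberTheory.EllipticCurves.FormalGroupPadicLogPointProofs
import Literature.NumberTheory.EllipticCurves.FormalGroupLogSummableProofs
import Literature.NumberTheory.EllipticCurves.PAdicHeightsLogProofs
import Literature.NumberTheory.LocalFields.PadicOneUnitHomRigidity
import HarnessLib

/-!
# The formal logarithm along Tate's parametrisation is `u⁻¹·log_p`
# (Stein–Wuthrich 2013 §4.2, "`ψ^*(ω_E) = C du/u`, so `log_E(P) = C log_p u(P)`"; proofs only)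

Topic `Literature/NumberTheory/EllipticCurves` (cluster `SteinWuthrich2013`); proof file (theorems
only, nothing asserted, no definition). Cell `bsd-eis`, seat `bsd-eis-k5-c4` g3: input (T2f) of the
discharge of the named fact `exists_isSplitMultCanonical` (`MultiplicativeHeightExistence.lean`;
crux 4 `BSDpOnCellC` of route `EisensteinPrimes`, stmt-BirchSwinnertonDyer-19034,
`stub_publishedFacts` conjunct `hHs`).

Let `W/ℚ` be `ℤ`-integral, `p` a prime, `0 < ‖q‖ < 1`, and `C = (u, r, s, t)` a `ℤ_p`-integral
change of variables (`‖u‖ = 1`, `‖r‖, ‖s‖, ‖t‖ ≤ 1`) with `C • (W ⊗ ℚ_p) = E_q` (as supplied by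
`SplitUniformizationDataProofs.exists_variableChange_tateCurve` at a split multiplicative prime).
Stein–Wuthrich (§4.2, p. 15) write `ψ : ℚ̄_p^× → E(ℚ̄_p)` for Tate's parametrisation composed with
this isomorphism, `ψ^*(ω_E) = C du/u`, and use `u(P) ∈ 1 + pℤ_p`, "the unique preimage of
`P ∈ Ê(pℤ_p)`", through `log_p u(P)`. Integrated, `ψ^*(ω_E) = C_SW du/u` says
`log_E(z(P)) = C_SW · log_p u(P)` with `C_SW = u⁻¹` (`ω_E = u⁻¹ω_{E_q}`, AEC III.1 Table 3.1). We
PROVE this: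

* `padicFormalLog_param_eq_inv_u_mul_padicLog` — for a rational point `P = (x,y)` of `E₁(ℚ_p)` and
  a one-unit `υ ≠ 1` with `(X(υ,q), Y(υ,q)) = (u⁻²(x−r), u⁻³(y − s(x−r) − t))` (the image of `P` on
  `E_q`): `log_{W ⊗ ℚ_p}(−x/y) = u⁻¹ · log_p υ`; hence
  `logUnitParamSq_eq_padicLog_sq` — `logUnitParamSq W p q x y = (log_p υ)²` when
  `(u⁻¹)² = uniformisationScaleSq W p q`.

Method (no power-series identity principle): `G(υ) := log_E(z(ψ(φ(υ))))` is an additive function of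
the one-unit `υ` (`φ` is a homomorphism — ATAEC V.3.1 (c), tree `tatePoint_mul` —, the change of
variables is an isomorphism of groups — tree `VariableChange.pointEquiv` —, and `log_E ∘ z` is
additive on `E₁(ℚ_p)` — AEC VII.2.2/IV.6.4, tree `formalGroupLaw_padicEval_holds`,
`padicFormalLog_padicEval₂_formalGroupLaw`), and `‖G(1+t) − u⁻¹t‖ ≤ 2‖t‖²` from three tangencies:
`z(φ(1+t)) = t + O(t²)` (principal parts `X(1+t) ≈ (1+t)/t²`, `Y(1+t) ≈ −(1+t)²/t³`, ATAEC §V.4,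
tree `UniformizationUnitEstimates`), `z(ψ(P')) = u⁻¹z(P') + O(z(P')²)` (AEC III.1), and
`log_E(z) = z + O(z²)` (AEC IV.5.5/IV.6.3). Since `log_p` is additive with `log_p(1+t) = t + O(t²)`,
`D = G − u⁻¹log_p` is an additive function on `1 + pℤ_p` bounded by `2‖υ − 1‖²`, hence `0`
(`LocalFields.eq_zero_of_mul_hom_of_norm_le_sq`: `pⁿD(υ) = D(υ^{pⁿ}) → 0` faster than `p⁻ⁿ`).

## Sources

* W. Stein, C. Wuthrich, Math. Comp. 82 (2013), §4.2 (p. 15). [SteinWuthrich2013]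
* J. H. Silverman, *Advanced Topics* (1994), Thm. V.3.1 (c), §V.4 (PDF pp. 399–402).
  [SilvermanATAEC1994]
* J. H. Silverman, *AEC* (2009), III.1 Table 3.1, IV.5.5, IV.6.3–6.4, VII.2.2. [SilvermanAEC2009]
* F. Q. Gouvêa, *p-adic Numbers* (1993), §5.7–5.8 (`log_p`). [Gouvea1993PadicNumbers]
-/

noncomputable section

open scoped Classical

open WeierstrassCurve PowerSeries Literature.NumberTheory.EllipticCurves
  Literature.NumberTheory.EllipticCurves.TateCurve Literature.NumberTheory.LocalFields

namespace Literature.NumberTheory.EllipticCurves.SteinWuthrich2013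

variable {p : ℕ} [hp : Fact p.Prime]

/-! ### Three tangency estimates -/

/-- `(n + 2) rⁿ ≤ 2` for `0 ≤ r ≤ 1/2`. [folklore] -/
private theorem aux_bound {r : ℝ} (hr0 : 0 ≤ r) (hr : r ≤ 1 / 2) (n : ℕ) :
    ((n : ℝ) + 2) * r ^ n ≤ 2 := by
  induction n with
  | zero => simp
  | succ n ih =>
    have h1 : ((n : ℝ) + 1 + 2) * r ^ (n + 1) = (((n : ℝ) + 3) * r) * r ^ n := by ring
    rw [Nat.cast_succ, h1]
    have h2 : ((n : ℝ) + 3) * r ≤ (n : ℝ) + 2 := by nlinarith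
    calc ((n : ℝ) + 3) * r * r ^ n ≤ ((n : ℝ) + 2) * r ^ n :=
          mul_le_mul_of_nonneg_right h2 (pow_nonneg hr0 n)
      _ ≤ 2 := ih

/-- `p⁻¹ ≤ 1/2`. [folklore] -/
private theorem inv_p_le_half : (p : ℝ)⁻¹ ≤ 1 / 2 := by
  rw [one_div]
  exact inv_anti₀ (by norm_num) (by exact_mod_cast hp.out.two_le)

/-- **`‖log_E(z) − z‖ ≤ 2‖z‖²` for `‖z‖ ≤ p⁻¹`** and a `p`-integral `E/ℚ_p`: `log_E(z) = z + Σ_{n≥2} cₙzⁿ`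
with `‖cₙ‖ ≤ n` (AEC IV.6.3(a); tree `norm_coeff_formalLog_le`) and `n rⁿ⁻² ≤ 2` for `r ≤ 1/2`.
(The variant with `‖z‖ ≤ p⁻²` is `Rank1Residual/Additive/PadicLogFormalGroup`'s; this is the
whole-`E₁` form.) [Silverman AEC IV.6.3(a), IV.6.4] [cite: SilvermanAEC2009, IV.6.3(a) and IV.6.4] -/
theorem norm_padicFormalLog_sub_self_le_two_mul_sq (V : WeierstrassCurve ℚ_[p]) [V.IsIntegral ℤ_[p]]
    {z : ℚ_[p]} (hz : ‖z‖ ≤ (p : ℝ)⁻¹) : ‖V.padicFormalLog z - z‖ ≤ 2 * ‖z‖ ^ 2 := by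
  set r := ‖z‖ with hr
  have hr0 : 0 ≤ r := norm_nonneg z
  have hr2 : r ≤ 1 / 2 := hz.trans inv_p_le_half
  have hr1 : r < 1 := by linarith
  have hsum : Summable fun n : ℕ => coeff n V.formalLog * z ^ n :=
    V.summable_formalLog_of_isIntegral z hr1
  have hsplit : V.padicFormalLog z = z + ∑' n : ℕ, coeff (n + 2) V.formalLog * z ^ (n + 2) := by
    rw [WeierstrassCurve.padicFormalLog, hsum.tsum_eq_zero_add,
      (summable_nat_add_iff 1 |>.mpr hsum).tsum_eq_zero_add]
    simp only [zero_add, pow_zero, mul_one, pow_one, WeierstrassCurve.coeff_one_formalLog, one_mul]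
    rw [show coeff 0 V.formalLog = 0 from by
      rw [PowerSeries.coeff_zero_eq_constantCoeff_apply]; exact V.constantCoeff_formalLog]
    ring_nf
  rw [hsplit, add_sub_cancel_left]
  refine IsUltrametricDist.norm_tsum_le_of_forall_le_of_nonneg (by positivity) fun n => ?_
  rw [norm_mul, norm_pow]
  calc ‖coeff (n + 2) V.formalLog‖ * r ^ (n + 2) ≤ ((n + 2 : ℕ) : ℝ) * r ^ (n + 2) :=
        mul_le_mul_of_nonneg_right (V.norm_coeff_formalLog_le (n + 2)) (pow_nonneg hr0 _)
    _ = (((n : ℝ) + 2) * r ^ n) * r ^ 2 := by push_cast; ring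
    _ ≤ 2 * r ^ 2 := mul_le_mul_of_nonneg_right (aux_bound hr0 hr2 n) (sq_nonneg _)

/-- **`‖log_p(1+t) − t‖ ≤ 2‖t‖²` for `‖t‖ ≤ p⁻¹`**: `log_p(1+t) = Σ_{n≥1} (−1)^{n+1}tⁿ/n`
(Gouvêa Lemma 5.7.1 / tree `hasSum_padicLog_holds`) with `‖tⁿ/n‖ ≤ n‖t‖ⁿ` and `n rⁿ⁻² ≤ 2`.
[Gouvêa 1993, §5.7 (Lemma 5.7.1, Prop. 5.7.8: `|log_p(1+x)| = |x|`-type estimates)]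
[cite: Gouvea1993PadicNumbers, §5.7 Prop. 5.7.8 (PDF p. 124)] -/
theorem norm_padicLog_one_add_sub_le {t : ℚ_[p]} (ht : ‖t‖ ≤ (p : ℝ)⁻¹) :
    ‖padicLog p (1 + t) - t‖ ≤ 2 * ‖t‖ ^ 2 := by
  set r := ‖t‖ with hr
  have hr0 : 0 ≤ r := norm_nonneg t
  have hr2 : r ≤ 1 / 2 := ht.trans inv_p_le_half
  have hr1 : r < 1 := by linarith
  have hsum := hasSum_padicLog_holds p (y := 1 + t) (by rw [add_sub_cancel_left]; exact hr1)
  have hsum' : HasSum (fun n : ℕ => -((-t) ^ (n + 1)) / (n + 1 : ℚ_[p])) (padicLog p (1 + t)) := by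
    refine hsum.congr_fun fun n => ?_
    rw [show (1 : ℚ_[p]) - (1 + t) = -t by ring]
  have hS : Summable fun n : ℕ => -((-t) ^ (n + 1)) / (n + 1 : ℚ_[p]) := hsum'.summable
  have hsplit : padicLog p (1 + t) = t + ∑' n : ℕ, -((-t) ^ (n + 2)) / (n + 2 : ℚ_[p]) := by
    rw [← hsum'.tsum_eq, hS.tsum_eq_zero_add]
    congr 1
    · simp
    · refine tsum_congr fun n => ?_
      push_cast
      ring_nf
  rw [hsplit, add_sub_cancel_left]
  refine IsUltrametricDist.norm_tsum_le_of_forall_le_of_nonneg (by positivity) fun n => ?_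
  have hn : ((n : ℚ_[p]) + 2) = ((n + 2 : ℕ) : ℚ_[p]) := by push_cast; ring
  rw [norm_div, norm_neg, norm_pow, norm_neg, hn, ← hr, div_eq_mul_inv, ← norm_inv]
  calc r ^ (n + 2) * ‖((n + 2 : ℕ) : ℚ_[p])⁻¹‖ ≤ r ^ (n + 2) * ((n + 2 : ℕ) : ℝ) :=
        mul_le_mul_of_nonneg_left (norm_inv_natCast_le (by omega)) (pow_nonneg hr0 _)
    _ = (((n : ℝ) + 2) * r ^ n) * r ^ 2 := by push_cast; ring
    _ ≤ 2 * r ^ 2 := mul_le_mul_of_nonneg_right (aux_bound hr0 hr2 n) (sq_nonneg _)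

/-- **`X(1+t,q) = (1+t)/t² + O(q)`** on the unit circle off `1`: `‖X(1+t,q) − (1+t)/t²‖ ≤ ‖q‖` for
`‖t‖ < 1` (so `‖1+t‖ = 1`; the principal part `u/(1−u)²` at `u = 1+t`; the remaining terms of
ATAEC p. 396 have norm `≤ ‖q‖`, tree `UniformizationUnitEstimates`).
[cite: SilvermanATAEC1994, §V.4 (PDF p. 401)] -/
theorem norm_tateX_one_add_sub_le {q t : ℚ_[p]} (hq : ‖q‖ < 1) (ht : ‖t‖ < 1) :
    ‖tateX q (1 + t) - (1 + t) / t ^ 2‖ ≤ ‖q‖ := by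
  have hu : ‖(1 : ℚ_[p]) + t‖ = 1 := by
    have := IsUltrametricDist.norm_add_eq_max_of_norm_ne_norm (x := (1 : ℚ_[p])) (y := t)
      (by rw [norm_one]; exact ht.ne')
    rw [this, norm_one, max_eq_left ht.le]
  have hui : ‖((1 : ℚ_[p]) + t)⁻¹‖ = 1 := by rw [norm_inv, hu, inv_one]
  have hpr : (1 + t) / (1 - (1 + t)) ^ 2 = (1 + t) / t ^ 2 := by ring
  rw [← hpr, tateX_sub_principal_eq hq (1 + t)]
  have hA : ‖∑' n : ℕ+, tateXTerm q (1 + t) n‖ ≤ ‖q‖ :=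
    IsUltrametricDist.norm_tsum_le_of_forall_le_of_nonneg (norm_nonneg q)
      fun n => norm_tateXTerm_pnat_le hq hu n
  have hB : ‖∑' n : ℕ+, tateXTerm q (1 + t)⁻¹ n‖ ≤ ‖q‖ :=
    IsUltrametricDist.norm_tsum_le_of_forall_le_of_nonneg (norm_nonneg q)
      fun n => norm_tateXTerm_pnat_le hq hui n
  have hC : ‖2 * tateS 1 q‖ ≤ ‖q‖ := by
    rw [norm_mul]
    calc ‖(2 : ℚ_[p])‖ * ‖tateS 1 q‖ ≤ 1 * ‖q‖ := by
          gcongr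
          · exact_mod_cast IsUltrametricDist.norm_natCast_le_one ℚ_[p] 2
          · exact norm_tateS_le hq.le
      _ = ‖q‖ := one_mul _
  have hAB : ‖(∑' n : ℕ+, tateXTerm q (1 + t) n) + ∑' n : ℕ+, tateXTerm q (1 + t)⁻¹ n‖ ≤ ‖q‖ :=
    (IsUltrametricDist.norm_add_le_max _ _).trans (max_le hA hB)
  have h := IsUltrametricDist.norm_add_le_max
    ((∑' n : ℕ+, tateXTerm q (1 + t) n) + ∑' n : ℕ+, tateXTerm q (1 + t)⁻¹ n) (-(2 * tateS 1 q))
  rw [norm_neg, ← sub_eq_add_neg] at h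
  exact h.trans (max_le hAB hC)

/-- **The Tate parameter is tangent to the formal parameter: `z(φ(1+t)) = t + O(t²)`.** For
`0 < ‖t‖ < 1` (and `‖q‖ < 1`), the point `φ(1+t) = (X(1+t,q), Y(1+t,q))` of `E_{q,1}` has
`z = −X/Y` with `‖z − t‖ ≤ ‖t‖²` and `‖z‖ = ‖t‖`: from `X = (1+t)/t² + O(q)`,
`Y = −(1+t)²/t³ + O(q)` one gets `−X/Y = t/(1+t) · (1 + O(qt²))`. (ATAEC §V.4: "`t ↦ −X(1+t,q)/Y(1+t,q)`
… `ψ(t) = t(1 + Σ γ_m t^m)`".) [cite: SilvermanATAEC1994, §V.4 (PDF p. 401)] -/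
theorem norm_tateParam_one_add_sub_le {q t : ℚ_[p]} (hq : ‖q‖ < 1) (ht : ‖t‖ < 1) (ht0 : t ≠ 0) :
    ‖-tateX q (1 + t) / tateY q (1 + t) - t‖ ≤ ‖t‖ ^ 2 ∧
      ‖-tateX q (1 + t) / tateY q (1 + t)‖ = ‖t‖ := by
  have htpos : 0 < ‖t‖ := norm_pos_iff.mpr ht0
  have hu : ‖(1 : ℚ_[p]) + t‖ = 1 := by
    have := IsUltrametricDist.norm_add_eq_max_of_norm_ne_norm (x := (1 : ℚ_[p])) (y := t)
      (by rw [norm_one]; exact ht.ne')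
    rw [this, norm_one, max_eq_left ht.le]
  have h1t0 : (1 : ℚ_[p]) + t ≠ 0 := by
    intro h; rw [h, norm_zero] at hu; exact zero_ne_one hu
  -- the two error terms
  set e₁ := tateX q (1 + t) - (1 + t) / t ^ 2 with he₁
  set e₂ := tateY q (1 + t) + (1 + t) ^ 2 / t ^ 3 with he₂
  have hne₁ : ‖e₁‖ ≤ ‖q‖ := norm_tateX_one_add_sub_le hq ht
  have hne₂ : ‖e₂‖ ≤ ‖q‖ := by
    have h := norm_tateY_sub_principal_le hq hu
    have e : (1 + t) ^ 2 / (1 - (1 + t)) ^ 3 = -((1 + t) ^ 2 / t ^ 3) := by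
      rw [show (1 : ℚ_[p]) - (1 + t) = -t by ring, neg_pow, show ((-1 : ℚ_[p]) ^ 3) = -1 by norm_num]
      ring
    rw [e, sub_neg_eq_add] at h
    exact h
  have hX : tateX q (1 + t) = ((1 + t) * t + e₁ * t ^ 3) / t ^ 3 := by
    rw [he₁]; field_simp; ring
  have hY : tateY q (1 + t) = (-(1 + t) ^ 2 + e₂ * t ^ 3) / t ^ 3 := by
    rw [he₂]; field_simp; ring
  -- `N := (1+t) t + e₁ t³`, `D := (1+t)² − e₂ t³`, `−X/Y = N/D`
  set N := (1 + t) * t + e₁ * t ^ 3 with hN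
  set D := (1 + t) ^ 2 - e₂ * t ^ 3 with hD
  have ht3 : t ^ 3 ≠ 0 := pow_ne_zero 3 ht0
  have hsmall₁ : ‖e₁ * t ^ 3‖ < ‖(1 + t) * t‖ := by
    rw [norm_mul, norm_mul, hu, one_mul, norm_pow]
    calc ‖e₁‖ * ‖t‖ ^ 3 ≤ 1 * ‖t‖ ^ 3 :=
          mul_le_mul_of_nonneg_right (hne₁.trans hq.le) (pow_nonneg htpos.le 3)
      _ = ‖t‖ * ‖t‖ ^ 2 := by ring
      _ < ‖t‖ * 1 := by
          apply mul_lt_mul_of_pos_left _ htpos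
          calc ‖t‖ ^ 2 < 1 ^ 2 := by gcongr
            _ = 1 := one_pow 2
      _ = ‖t‖ := mul_one _
  have hNn : ‖N‖ = ‖t‖ := by
    rw [hN, IsUltrametricDist.norm_add_eq_max_of_norm_ne_norm hsmall₁.ne', max_eq_left hsmall₁.le,
      norm_mul, hu, one_mul]
  have hsmall₂ : ‖-(e₂ * t ^ 3)‖ < ‖(1 + t) ^ 2‖ := by
    rw [norm_neg, norm_mul, norm_pow, norm_pow, hu, one_pow]
    calc ‖e₂‖ * ‖t‖ ^ 3 ≤ 1 * ‖t‖ ^ 3 :=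
          mul_le_mul_of_nonneg_right (hne₂.trans hq.le) (pow_nonneg htpos.le 3)
      _ < 1 := by rw [one_mul]; exact pow_lt_one₀ htpos.le ht (by norm_num)
  have hDn : ‖D‖ = 1 := by
    rw [hD, sub_eq_add_neg, IsUltrametricDist.norm_add_eq_max_of_norm_ne_norm hsmall₂.ne',
      max_eq_left hsmall₂.le, norm_pow, hu, one_pow]
  have hD0 : D ≠ 0 := by intro h; rw [h, norm_zero] at hDn; exact zero_ne_one hDn
  have hquot : -tateX q (1 + t) / tateY q (1 + t) = N / D := by
    have hY' : tateY q (1 + t) = -D / t ^ 3 := by rw [hY, hD]; ring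
    rw [hX, hY']
    field_simp
  rw [hquot]
  refine ⟨?_, by rw [norm_div, hNn, hDn, div_one]⟩
  -- `N/D − t = (N − tD)/D`, `N − tD = −t²(1+t) + (e₁ + e₂(1+t)… ) t³`-type: norm ≤ ‖t‖²
  have hdiff : N / D - t = (N - t * D) / D := by field_simp
  have hnum : N - t * D = -(1 + t) * t ^ 2 + (e₁ + t * e₂) * t ^ 3 := by
    rw [hN, hD]; ring
  rw [hdiff, norm_div, hDn, div_one, hnum]
  refine (IsUltrametricDist.norm_add_le_max _ _).trans (max_le ?_ ?_)
  · rw [norm_mul, norm_neg, hu, one_mul, norm_pow]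
  · rw [norm_mul, norm_pow]
    have he : ‖e₁ + t * e₂‖ ≤ 1 := by
      refine (IsUltrametricDist.norm_add_le_max _ _).trans (max_le (hne₁.trans hq.le) ?_)
      rw [norm_mul]
      calc ‖t‖ * ‖e₂‖ ≤ 1 * 1 := mul_le_mul ht.le (hne₂.trans hq.le) (norm_nonneg _) zero_le_one
        _ = 1 := mul_one _
    calc ‖e₁ + t * e₂‖ * ‖t‖ ^ 3 ≤ 1 * ‖t‖ ^ 3 :=
          mul_le_mul_of_nonneg_right he (pow_nonneg htpos.le 3)
      _ = ‖t‖ ^ 2 * ‖t‖ := by ring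
      _ ≤ ‖t‖ ^ 2 * 1 := mul_le_mul_of_nonneg_left ht.le (sq_nonneg _)
      _ = ‖t‖ ^ 2 := mul_one _

/-- **The change of variables is tangent to `z ↦ u⁻¹z` on `E₁`.** Let `C = (u,r,s,t)` be
`ℤ_p`-integral with `‖u‖ = 1` and `C • E = E_q` (`‖q‖ < 1`). For a point `(x', y')` of `E_q` with
`‖x'‖ > 1`, the corresponding point `(x, y) = (u²x' + r, u³y' + u²sx' + t)` of `E` satisfies
`‖x‖ = ‖x'‖ > 1`, `y ≠ 0`, and `‖(−x/y) − u⁻¹(−x'/y')‖ ≤ ‖x'/y'‖²` (AEC III.1 Table 3.1: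
`z = u⁻¹z'(1 + O(z'))`; here `‖y'‖² = ‖x'‖³`, ATAEC Lemma V.4.1.1). [Silverman AEC III.1 Table 3.1;
ATAEC §V.4 Lemma 4.1.1] [cite: SilvermanAEC2009, III.1 Table 3.1] -/
theorem norm_param_ofXY_sub_le {E : WeierstrassCurve ℚ_[p]} {q : ℚ_[p]} (hq : ‖q‖ < 1)
    {C : VariableChange ℚ_[p]} (hC : C • E = tateCurve q) (hu : ‖(C.u : ℚ_[p])‖ = 1)
    (hr : ‖C.r‖ ≤ 1) (hs : ‖C.s‖ ≤ 1) (ht : ‖C.t‖ ≤ 1) {x' y' : ℚ_[p]}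
    (h' : (C • E).toAffine.Nonsingular x' y') (hx' : 1 < ‖x'‖) :
    1 < ‖C.ofX x'‖ ∧ C.ofY x' y' ≠ 0 ∧
      ‖-C.ofX x' / C.ofY x' y' - (C.u : ℚ_[p])⁻¹ * (-x' / y')‖ ≤ ‖-x' / y'‖ ^ 2 := by
  have heq : y' ^ 2 + x' * y' = x' ^ 3 + tateA4 q * x' + tateA6 q := by
    rw [hC] at h'
    have h1 := h'.1
    rw [WeierstrassCurve.Affine.equation_iff] at h1
    simp only [tateCurve] at h1
    linear_combination h1
  have ha4 : ‖tateA4 q‖ < 1 := (norm_tateA4_le hq.le).trans_lt hq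
  have ha6 : ‖tateA6 q‖ < 1 := (norm_tateA6_le hq (by norm_num)).trans_lt hq
  obtain ⟨hxy, hsq⟩ := norm_lt_norm_y_of_one_lt_norm_x heq ha4 ha6 hx'
  have hx0 : 0 < ‖x'‖ := one_pos.trans hx'
  have hy0' : 0 < ‖y'‖ := hx0.trans hxy
  have hy0 : y' ≠ 0 := norm_pos_iff.mp hy0'
  have hu0 : (C.u : ℚ_[p]) ≠ 0 := C.u.ne_zero
  have hyx2 : ‖y'‖ ≤ ‖x'‖ ^ 2 := by
    have : ‖y'‖ ^ 2 ≤ (‖x'‖ ^ 2) ^ 2 := by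
      rw [hsq]
      calc ‖x'‖ ^ 3 = ‖x'‖ ^ 2 * ‖x'‖ := by ring
        _ ≤ ‖x'‖ ^ 2 * ‖x'‖ ^ 2 := by
            apply mul_le_mul_of_nonneg_left _ (sq_nonneg _)
            calc ‖x'‖ = ‖x'‖ ^ 1 := (pow_one _).symm
              _ ≤ ‖x'‖ ^ 2 := pow_le_pow_right₀ hx'.le (by norm_num)
        _ = (‖x'‖ ^ 2) ^ 2 := by ring
    exact (pow_le_pow_iff_left₀ (norm_nonneg _) (sq_nonneg _) two_ne_zero).mp this
  -- `x = u² x' + r` has norm `‖x'‖`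
  have hxn : ‖C.ofX x'‖ = ‖x'‖ := by
    have h1 : ‖(C.u : ℚ_[p]) ^ 2 * x'‖ = ‖x'‖ := by rw [norm_mul, norm_pow, hu, one_pow, one_mul]
    have hne : ‖(C.u : ℚ_[p]) ^ 2 * x'‖ ≠ ‖C.r‖ := by rw [h1]; exact (hr.trans_lt hx').ne'
    show ‖(C.u : ℚ_[p]) ^ 2 * x' + C.r‖ = ‖x'‖
    rw [IsUltrametricDist.norm_add_eq_max_of_norm_ne_norm hne, h1, max_eq_left (hr.trans hx'.le)]
  -- `Yd := u³y' + u²s x' + t` has norm `‖y'‖`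
  have hYd : ‖C.ofY x' y'‖ = ‖y'‖ := by
    have h1 : ‖(C.u : ℚ_[p]) ^ 3 * y'‖ = ‖y'‖ := by rw [norm_mul, norm_pow, hu, one_pow, one_mul]
    have h2 : ‖(C.u : ℚ_[p]) ^ 2 * C.s * x' + C.t‖ < ‖y'‖ := by
      refine (IsUltrametricDist.norm_add_le_max _ _).trans_lt (max_lt ?_ (ht.trans_lt (hx'.trans hxy)))
      rw [norm_mul, norm_mul, norm_pow, hu, one_pow, one_mul]
      calc ‖C.s‖ * ‖x'‖ ≤ 1 * ‖x'‖ := mul_le_mul_of_nonneg_right hs (norm_nonneg _)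
        _ < ‖y'‖ := by rw [one_mul]; exact hxy
    have hne : ‖(C.u : ℚ_[p]) ^ 3 * y'‖ ≠ ‖(C.u : ℚ_[p]) ^ 2 * C.s * x' + C.t‖ := by
      rw [h1]; exact h2.ne'
    show ‖(C.u : ℚ_[p]) ^ 3 * y' + (C.u : ℚ_[p]) ^ 2 * C.s * x' + C.t‖ = ‖y'‖
    rw [add_assoc, IsUltrametricDist.norm_add_eq_max_of_norm_ne_norm hne, h1, max_eq_left h2.le]
  have hYd0 : C.ofY x' y' ≠ 0 := by
    intro h0; rw [h0, norm_zero] at hYd; exact hy0'.ne hYd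
  refine ⟨by rw [hxn]; exact hx', hYd0, ?_⟩
  -- the difference over a common denominator
  have key : -C.ofX x' / C.ofY x' y' - (C.u : ℚ_[p])⁻¹ * (-x' / y') =
      (-(C.r * C.u * y') + (C.u : ℚ_[p]) ^ 2 * C.s * x' ^ 2 + C.t * x') /
        ((C.u : ℚ_[p]) * y' * C.ofY x' y') := by
    have e1 : C.ofX x' = (C.u : ℚ_[p]) ^ 2 * x' + C.r := rfl
    have e2 : C.ofY x' y' = (C.u : ℚ_[p]) ^ 3 * y' + (C.u : ℚ_[p]) ^ 2 * C.s * x' + C.t := rfl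
    set Yd := C.ofY x' y' with hYd_def
    rw [e1, eq_div_iff (mul_ne_zero (mul_ne_zero hu0 hy0) hYd0)]
    field_simp
    rw [e2]
    ring
  rw [key, norm_div, norm_mul, norm_mul, hu, one_mul, hYd]
  have hnum : ‖-(C.r * C.u * y') + (C.u : ℚ_[p]) ^ 2 * C.s * x' ^ 2 + C.t * x'‖ ≤ ‖x'‖ ^ 2 := by
    refine (IsUltrametricDist.norm_add_le_max _ _).trans (max_le ?_ ?_)
    · refine (IsUltrametricDist.norm_add_le_max _ _).trans (max_le ?_ ?_)
      · rw [norm_neg, norm_mul, norm_mul, hu, mul_one]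
        calc ‖C.r‖ * ‖y'‖ ≤ 1 * ‖x'‖ ^ 2 := mul_le_mul hr hyx2 (norm_nonneg _) zero_le_one
          _ = ‖x'‖ ^ 2 := one_mul _
      · rw [norm_mul, norm_mul, norm_pow, norm_pow, hu, one_pow, one_mul]
        calc ‖C.s‖ * ‖x'‖ ^ 2 ≤ 1 * ‖x'‖ ^ 2 := mul_le_mul_of_nonneg_right hs (sq_nonneg _)
          _ = ‖x'‖ ^ 2 := one_mul _
    · rw [norm_mul]
      calc ‖C.t‖ * ‖x'‖ ≤ 1 * ‖x'‖ ^ 2 := by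
            refine mul_le_mul ht ?_ (norm_nonneg _) zero_le_one
            calc ‖x'‖ = ‖x'‖ ^ 1 := (pow_one _).symm
              _ ≤ ‖x'‖ ^ 2 := pow_le_pow_right₀ hx'.le (by norm_num)
        _ = ‖x'‖ ^ 2 := one_mul _
  rw [div_le_iff₀ (mul_pos hy0' hy0'), norm_div, norm_neg, div_pow,
    div_mul_eq_mul_div, le_div_iff₀ (pow_pos hy0' 2)]
  calc ‖-(C.r * ↑C.u * y') + ↑C.u ^ 2 * C.s * x' ^ 2 + C.t * x'‖ * ‖y'‖ ^ 2
      ≤ ‖x'‖ ^ 2 * ‖y'‖ ^ 2 := mul_le_mul_of_nonneg_right hnum (sq_nonneg _)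
    _ = ‖x'‖ ^ 2 * (‖y'‖ * ‖y'‖) := by ring

/-! ### Additivity of Tate coordinates on `T = E_q` (as points of any `T` equal to `E_q`) -/

/-- `φ(u) + φ(v) = φ(uv)` on coordinates, for `u, v, uv ∉ q^ℤ`, read on any Weierstrass equation
`T` EQUAL to `E_q`. [cite: SilvermanATAEC1994, Thm. V.3.1 (c) (PDF pp. 397–398)] -/
theorem tate_some_add_some {q : ℚ_[p]} (hq0 : q ≠ 0) (hq : ‖q‖ < 1) (T : WeierstrassCurve ℚ_[p])
    (hT : T = tateCurve q) {u v : ℚ_[p]ˣ} (hu : ∀ n : ℤ, (u : ℚ_[p]) ≠ q ^ n)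
    (hv : ∀ n : ℤ, (v : ℚ_[p]) ≠ q ^ n) (huv : ∀ n : ℤ, ((u * v : ℚ_[p]ˣ) : ℚ_[p]) ≠ q ^ n)
    (h₁ : T.toAffine.Nonsingular (tateX q u) (tateY q u))
    (h₂ : T.toAffine.Nonsingular (tateX q v) (tateY q v))
    (h₃ : T.toAffine.Nonsingular (tateX q (u * v : ℚ_[p]ˣ)) (tateY q (u * v : ℚ_[p]ˣ))) :
    (.some _ _ h₁ : T.toAffine.Point) + .some _ _ h₂ = .some _ _ h₃ := by
  subst hT
  have hmul := tatePoint_mul (K := ℚ_[p]) addRelX_eq_zero addRelY_eq_zero hq0 hq u v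
  rw [tatePoint_of_ne_zpow hq0 hq u hu, tatePoint_of_ne_zpow hq0 hq v hv,
    tatePoint_of_ne_zpow hq0 hq _ huv] at hmul
  exact hmul.symm

/-- `φ(u) + φ(v) = O` on coordinates when `uv ∈ q^ℤ`. [cite: SilvermanATAEC1994, Thm. V.3.1 (c) (PDF pp. 397–398)] -/
theorem tate_some_add_some_eq_zero {q : ℚ_[p]} (hq0 : q ≠ 0) (hq : ‖q‖ < 1)
    (T : WeierstrassCurve ℚ_[p]) (hT : T = tateCurve q) {u v : ℚ_[p]ˣ}
    (hu : ∀ n : ℤ, (u : ℚ_[p]) ≠ q ^ n) (hv : ∀ n : ℤ, (v : ℚ_[p]) ≠ q ^ n) {n : ℤ}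
    (huv : ((u * v : ℚ_[p]ˣ) : ℚ_[p]) = q ^ n)
    (h₁ : T.toAffine.Nonsingular (tateX q u) (tateY q u))
    (h₂ : T.toAffine.Nonsingular (tateX q v) (tateY q v)) :
    (.some _ _ h₁ : T.toAffine.Point) + .some _ _ h₂ = 0 := by
  subst hT
  have hmul := tatePoint_mul (K := ℚ_[p]) addRelX_eq_zero addRelY_eq_zero hq0 hq u v
  rw [tatePoint_of_ne_zpow hq0 hq u hu, tatePoint_of_ne_zpow hq0 hq v hv,
    tatePoint_of_eq_zpow (u * v) huv] at hmul
  exact hmul.symm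

/-- **`log_E ∘ z` is additive on `E₁(ℚ_p)`** (all `ℚ_p`-points; `p`-integral `E`): for `P, Q` with
`P = O` or `‖x(P)‖ > 1`, and likewise `Q`, `log_E(z(P+Q)) = log_E(z(P)) + log_E(z(Q))`.
[Silverman AEC VII.2.2, IV.6.4(a)] [cite: SilvermanAEC2009, VII.2.2 and IV.6.4(a)] -/
theorem padicFormalLog_formalParameter_add (V : WeierstrassCurve ℚ_[p]) [V.IsIntegral ℤ_[p]]
    {P Q : V.toAffine.Point} (hP : V.IsInReductionKernel P) (hQ : V.IsInReductionKernel Q) :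
    V.padicFormalLog (V.formalParameter (P + Q)) =
      V.padicFormalLog (V.formalParameter P) + V.padicFormalLog (V.formalParameter Q) := by
  rw [← V.padicEval₂_formalGroupLaw_eq_formalParameter_add hP hQ]
  exact V.padicFormalLog_padicEval₂_formalGroupLaw (V.norm_formalParameter_lt_one hP)
    (V.norm_formalParameter_lt_one hQ)

/-! ### Small `ℚ_p` facts -/

/-- In `ℚ_p`, `‖x‖ < 1` forces `‖x‖ ≤ p⁻¹` (the value group is `p^ℤ`). [folklore] -/
private theorem norm_le_inv_of_norm_lt_one {x : ℚ_[p]} (h : ‖x‖ < 1) : ‖x‖ ≤ (p : ℝ)⁻¹ := by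
  by_cases hx : x = 0
  · rw [hx, norm_zero]; exact inv_nonneg.mpr (by positivity)
  have hp1 : (1 : ℝ) < p := by exact_mod_cast hp.out.one_lt
  rw [Padic.norm_eq_zpow_neg_valuation hx] at h ⊢
  have hv : 0 < x.valuation := by
    by_contra hle
    push Not at hle
    have : (1 : ℝ) ≤ (p : ℝ) ^ (-x.valuation) := one_le_zpow₀ hp1.le (by omega)
    exact absurd h (not_lt.mpr this)
  rw [← zpow_neg_one]
  exact zpow_le_zpow_right₀ hp1.le (by omega)

/-- One-units have norm `1`. [folklore] -/
private theorem norm_eq_one_of_norm_sub_one_lt {v : ℚ_[p]} (hv : ‖v - 1‖ < 1) : ‖v‖ = 1 := by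
  have := IsUltrametricDist.norm_add_eq_max_of_norm_ne_norm (x := v - 1) (y := (1 : ℚ_[p]))
    (by rw [norm_one]; exact hv.ne)
  rw [sub_add_cancel, norm_one, max_eq_right hv.le] at this
  exact this

/-- The one-units form a group: `‖vw − 1‖ < 1`. [folklore] -/
private theorem norm_mul_sub_one_lt {v w : ℚ_[p]} (hv : ‖v - 1‖ < 1) (hw : ‖w - 1‖ < 1) :
    ‖v * w - 1‖ < 1 := by
  have e : v * w - 1 = (v - 1) * w + (w - 1) := by ring
  rw [e]
  refine (IsUltrametricDist.norm_add_le_max _ _).trans_lt (max_lt ?_ hw)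
  rw [norm_mul, norm_eq_one_of_norm_sub_one_lt hw, mul_one]
  exact hv

/-- `‖X(1+t,q)‖ = ‖t‖⁻² > 1` for `0 < ‖t‖ < 1`. [cite: SilvermanATAEC1994, §V.4 (PDF p. 401)] -/
theorem one_lt_norm_tateX_one_add {q t : ℚ_[p]} (hq : ‖q‖ < 1) (ht : ‖t‖ < 1) (ht0 : t ≠ 0) :
    1 < ‖tateX q (1 + t)‖ := by
  have htpos : 0 < ‖t‖ := norm_pos_iff.mpr ht0
  have hu : ‖(1 : ℚ_[p]) + t‖ = 1 := by
    have := IsUltrametricDist.norm_add_eq_max_of_norm_ne_norm (x := (1 : ℚ_[p])) (y := t)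
      (by rw [norm_one]; exact ht.ne')
    rw [this, norm_one, max_eq_left ht.le]
  have hpr : ‖((1 : ℚ_[p]) + t) / t ^ 2‖ = (‖t‖ ^ 2)⁻¹ := by
    rw [norm_div, hu, norm_pow, one_div]
  have hbig : 1 < ‖((1 : ℚ_[p]) + t) / t ^ 2‖ := by
    rw [hpr]
    exact one_lt_inv_iff₀.mpr ⟨pow_pos htpos 2, pow_lt_one₀ htpos.le ht two_ne_zero⟩
  have hne : ‖((1 : ℚ_[p]) + t) / t ^ 2‖ ≠ ‖tateX q (1 + t) - (1 + t) / t ^ 2‖ :=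
    (((norm_tateX_one_add_sub_le hq ht).trans hq.le).trans_lt hbig).ne'
  have e : tateX q (1 + t) = (1 + t) / t ^ 2 + (tateX q (1 + t) - (1 + t) / t ^ 2) := by ring
  rw [e, IsUltrametricDist.norm_add_eq_max_of_norm_ne_norm hne]
  exact lt_max_of_lt_left hbig

/-! ### The main theorem: `log_E(z(P)) = u⁻¹ log_p υ(P)` -/

/-- **Stein–Wuthrich's `ψ^*(ω_E) = C du/u`, integrated: `log_E(z(P)) = u⁻¹·log_p υ(P)`.** Let
`W/ℚ` be `ℤ`-integral elliptic, `p` a prime, `0 < ‖q‖_p < 1`, and `C = (u,r,s,t)` a `ℤ_p`-integral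
change of variables (`‖u‖ = 1`, `‖r‖,‖s‖,‖t‖ ≤ 1`) with `C • (W ⊗ ℚ_p) = E_q`. If `P = (x,y) ∈ E(ℚ)`
lies in `E₁(ℚ_p)` and `υ ∈ 1 + pℤ_p`, `υ ≠ 1`, is its Tate parameter —
`(X(υ,q), Y(υ,q)) = (u⁻²(x−r), u⁻³(y − s(x−r) − t))` — then the `p`-adic formal logarithm of
`W ⊗ ℚ_p` at `z(P) = −x/y` is `u⁻¹ · log_p υ` (only the two coordinate identities are used: they
force `(x, y)` to be the image of `φ(υ) ∈ E_{q,1}`). Proof: `G(v) = log_E(z(ψφ(v)))` and `u⁻¹log_p` are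
additive on `1 + pℤ_p` and agree to second order at `1`, so they coincide
(`LocalFields.eq_zero_of_mul_hom_of_norm_le_sq`). [Stein–Wuthrich 2013, §4.2 (p. 15);
Silverman ATAEC V.3.1 (c), §V.4; AEC III.1, IV.6, VII.2.2] [cite: SteinWuthrich2013, §4.2 (p. 15)]
[cite: SilvermanATAEC1994, Thm. V.3.1 (c) and §V.4 (PDF pp. 395–402)] -/
theorem padicFormalLog_param_eq_inv_u_mul_padicLog (W : WeierstrassCurve ℚ) [W.IsElliptic]
    [W.IsIntegral ℤ] {q : ℚ_[p]} (hq0 : q ≠ 0) (hq : ‖q‖ < 1) {C : VariableChange ℚ_[p]}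
    (hC : C • W.baseChange ℚ_[p] = tateCurve q) (hu : ‖(C.u : ℚ_[p])‖ = 1) (hr : ‖C.r‖ ≤ 1)
    (hs : ‖C.s‖ ≤ 1) (ht : ‖C.t‖ ≤ 1) {x y : ℚ} {υ : ℚ_[p]} (hυ1 : ‖υ - 1‖ < 1) (hυne : υ ≠ 1)
    (hX : tateX q υ = C.toX (x : ℚ_[p])) (hY : tateY q υ = C.toY (x : ℚ_[p]) (y : ℚ_[p])) :
    (W.baseChange ℚ_[p]).padicFormalLog (-(x : ℚ_[p]) / y) = (C.u : ℚ_[p])⁻¹ * padicLog p υ := by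
  set E : WeierstrassCurve ℚ_[p] := W.baseChange ℚ_[p] with hE
  haveI : E.IsIntegral ℤ_[p] := by rw [hE]; infer_instance
  set T : WeierstrassCurve ℚ_[p] := C • E with hT
  have hu0 : (C.u : ℚ_[p]) ≠ 0 := C.u.ne_zero
  have hui : ‖(C.u : ℚ_[p])⁻¹‖ = 1 := by rw [norm_inv, hu, inv_one]
  -- one-units `v ≠ 1` are off `q^ℤ` and give points of `T = E_q`
  have hvq : ∀ {v : ℚ_[p]}, ‖v - 1‖ < 1 → v ≠ 1 → ∀ n : ℤ, v ≠ q ^ n := fun hv hne =>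
    ne_zpow_of_norm_eq_one hq (norm_eq_one_of_norm_sub_one_lt hv) hne
  have hv0 : ∀ {v : ℚ_[p]}, ‖v - 1‖ < 1 → v ≠ 0 := fun hv h0 => by
    have := norm_eq_one_of_norm_sub_one_lt hv; rw [h0, norm_zero] at this; exact zero_ne_one this
  have nonsT : ∀ {v : ℚ_[p]} (hv : ‖v - 1‖ < 1 ∧ v ≠ 1),
      T.toAffine.Nonsingular (tateX q v) (tateY q v) := by
    intro v hv
    have hns := tatePoint_nonsingular hq0 hq (Units.mk0 v (hv0 hv.1)) (hvq hv.1 hv.2)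
    rw [← hC] at hns
    exact hns
  -- the points `Pt v` of `T` and the function `G`
  let Pt : ℚ_[p] → T.toAffine.Point := fun v =>
    if hv : ‖v - 1‖ < 1 ∧ v ≠ 1 then .some _ _ (nonsT hv) else 0
  have Pt_pos : ∀ {v : ℚ_[p]} (hv : ‖v - 1‖ < 1 ∧ v ≠ 1), Pt v = .some _ _ (nonsT hv) :=
    fun hv => dif_pos hv
  have Pt_one : Pt 1 = 0 := dif_neg (by simp)
  let G : ℚ_[p] → ℚ_[p] := fun v =>
    E.padicFormalLog (E.formalParameter ((VariableChange.pointEquiv E C).symm (Pt v)))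
  -- (A) additivity of `Pt`
  have Pt_mul : ∀ {v w : ℚ_[p]}, ‖v - 1‖ < 1 → ‖w - 1‖ < 1 → Pt (v * w) = Pt v + Pt w := by
    intro v w hv hw
    by_cases hv1 : v = 1
    · rw [hv1, one_mul, Pt_one, zero_add]
    by_cases hw1 : w = 1
    · rw [hw1, mul_one, Pt_one, add_zero]
    rw [Pt_pos ⟨hv, hv1⟩, Pt_pos ⟨hw, hw1⟩]
    by_cases hvw : v * w = 1
    · rw [hvw, Pt_one]
      exact (tate_some_add_some_eq_zero hq0 hq T (hT.trans hC) (u := Units.mk0 v (hv0 hv))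
        (v := Units.mk0 w (hv0 hw)) (hvq hv hv1) (hvq hw hw1) (n := 0)
        (by rw [zpow_zero]; exact hvw) _ _).symm
    · have hvw' : ‖v * w - 1‖ < 1 ∧ v * w ≠ 1 := ⟨norm_mul_sub_one_lt hv hw, hvw⟩
      rw [Pt_pos hvw']
      exact (tate_some_add_some hq0 hq T (hT.trans hC) (u := Units.mk0 v (hv0 hv))
        (v := Units.mk0 w (hv0 hw)) (hvq hv hv1) (hvq hw hw1) (hvq hvw'.1 hvw'.2) _ _
        (nonsT hvw')).symm
  -- (B) `ψ (Pt v) ∈ E₁(ℚ_p)`, with the tangency `z(ψ(Pt(1+t))) ≈ u⁻¹ t`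
  have mem : ∀ {v : ℚ_[p]}, ‖v - 1‖ < 1 →
      E.IsInReductionKernel ((VariableChange.pointEquiv E C).symm (Pt v)) := by
    intro v hv
    by_cases hv1 : v = 1
    · rw [hv1, Pt_one, map_zero]; exact E.isInReductionKernel_zero
    rw [Pt_pos ⟨hv, hv1⟩, VariableChange.pointEquiv_symm_apply, VariableChange.pointInv_some]
    have hXv : 1 < ‖tateX q v‖ := by
      have := one_lt_norm_tateX_one_add hq hv (sub_ne_zero.mpr hv1) (t := v - 1)
      rwa [add_sub_cancel] at this
    exact (norm_param_ofXY_sub_le hq hC hu hr hs ht (nonsT ⟨hv, hv1⟩) hXv).1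
  -- (C) `G` is additive on one-units
  have G_mul : ∀ v w : ℚ_[p], ‖v - 1‖ ≤ (p : ℝ)⁻¹ → ‖w - 1‖ ≤ (p : ℝ)⁻¹ →
      G (v * w) = G v + G w := by
    intro v w hv hw
    have hp1 : (p : ℝ)⁻¹ < 1 := inv_lt_one_of_one_lt₀ (by exact_mod_cast hp.out.one_lt)
    have hv' := hv.trans_lt hp1
    have hw' := hw.trans_lt hp1
    show E.padicFormalLog (E.formalParameter ((VariableChange.pointEquiv E C).symm (Pt (v * w)))) =
      E.padicFormalLog (E.formalParameter ((VariableChange.pointEquiv E C).symm (Pt v))) +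
        E.padicFormalLog (E.formalParameter ((VariableChange.pointEquiv E C).symm (Pt w)))
    rw [Pt_mul hv' hw', map_add]
    exact padicFormalLog_formalParameter_add E (mem hv') (mem hw')
  -- (D) tangency: `‖G v − u⁻¹ log_p v‖ ≤ 2‖v − 1‖²`
  have G_tan : ∀ v : ℚ_[p], ‖v - 1‖ ≤ (p : ℝ)⁻¹ →
      ‖(G v - (C.u : ℚ_[p])⁻¹ * padicLog p v)‖ ≤ 2 * ‖v - 1‖ ^ 2 := by
    intro v hv
    have hp1 : (p : ℝ)⁻¹ < 1 := inv_lt_one_of_one_lt₀ (by exact_mod_cast hp.out.one_lt)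
    have hv' := hv.trans_lt hp1
    by_cases hv1 : v = 1
    · have hG1 : G 1 = 0 := by
        show E.padicFormalLog (E.formalParameter ((VariableChange.pointEquiv E C).symm (Pt 1))) = 0
        rw [Pt_one, map_zero, E.formalParameter_zero, E.padicFormalLog_zero]
      have hl1 : padicLog p 1 = 0 := by
        have h1 := padicLog_mul_holds p (x := 1) (y := 1) one_ne_zero one_ne_zero
        rw [mul_one] at h1; linear_combination -h1
      rw [hv1, hG1, hl1, mul_zero, sub_zero, norm_zero]
      positivity
    set t := v - 1 with htdef
    have ht0 : t ≠ 0 := sub_ne_zero.mpr hv1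
    have htv : v = 1 + t := by rw [htdef]; ring
    have hvv : ‖v - 1‖ < 1 ∧ v ≠ 1 := ⟨hv', hv1⟩
    -- `z' = −X/Y` and `z = z(ψ(Pt v))`
    obtain ⟨hz't, hz'n⟩ := norm_tateParam_one_add_sub_le hq hv' ht0 (q := q)
    rw [← htv] at hz't hz'n
    have hXv : 1 < ‖tateX q v‖ := by
      have := one_lt_norm_tateX_one_add hq hv' ht0; rwa [← htv] at this
    obtain ⟨-, hofY0, hzz'⟩ := norm_param_ofXY_sub_le hq hC hu hr hs ht (nonsT hvv) hXv
    have hGv : G v = E.padicFormalLog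
        (-C.ofX (tateX q v) / C.ofY (tateX q v) (tateY q v)) := by
      show E.padicFormalLog (E.formalParameter ((VariableChange.pointEquiv E C).symm (Pt v))) = _
      rw [Pt_pos hvv, VariableChange.pointEquiv_symm_apply, VariableChange.pointInv_some,
        E.formalParameter_some]
    set z := -C.ofX (tateX q v) / C.ofY (tateX q v) (tateY q v) with hzdef
    set z' := -tateX q v / tateY q v with hz'def
    -- norms
    have hzz'' : ‖z - (C.u : ℚ_[p])⁻¹ * z'‖ ≤ ‖t‖ ^ 2 := by rw [← hz'n]; exact hzz'
    have huz' : ‖(C.u : ℚ_[p])⁻¹ * z'‖ = ‖t‖ := by rw [norm_mul, hui, one_mul, hz'n]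
    have htpos : 0 < ‖t‖ := norm_pos_iff.mpr ht0
    have hzn : ‖z‖ = ‖t‖ := by
      have hlt : ‖z - (C.u : ℚ_[p])⁻¹ * z'‖ < ‖(C.u : ℚ_[p])⁻¹ * z'‖ := by
        rw [huz']
        refine hzz''.trans_lt ?_
        calc ‖t‖ ^ 2 = ‖t‖ * ‖t‖ := sq _
          _ < ‖t‖ * 1 := mul_lt_mul_of_pos_left hv' htpos
          _ = ‖t‖ := mul_one _
      have := IsUltrametricDist.norm_add_eq_max_of_norm_ne_norm hlt.ne
      rw [sub_add_cancel, max_eq_right hlt.le, huz'] at this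
      exact this
    have hlog : ‖E.padicFormalLog z - z‖ ≤ 2 * ‖t‖ ^ 2 := by
      rw [← hzn]; exact norm_padicFormalLog_sub_self_le_two_mul_sq E (by rw [hzn]; exact hv)
    have hlp : ‖padicLog p v - t‖ ≤ 2 * ‖t‖ ^ 2 := by rw [htv]; exact norm_padicLog_one_add_sub_le hv
    -- combine
    have e : G v - (C.u : ℚ_[p])⁻¹ * padicLog p v =
        (E.padicFormalLog z - z) + (z - (C.u : ℚ_[p])⁻¹ * z') +
          (C.u : ℚ_[p])⁻¹ * ((z' - t) - (padicLog p v - t)) := by rw [hGv]; ring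
    rw [e]
    have ht2 : ‖t‖ ^ 2 ≤ 2 * ‖t‖ ^ 2 := by nlinarith [sq_nonneg ‖t‖]
    refine (IsUltrametricDist.norm_add_le_max _ _).trans (max_le ?_ ?_)
    · exact (IsUltrametricDist.norm_add_le_max _ _).trans (max_le hlog (hzz''.trans ht2))
    · rw [norm_mul, hui, one_mul, sub_eq_add_neg (z' - t)]
      refine (IsUltrametricDist.norm_add_le_max _ _).trans (max_le (hz't.trans ht2) ?_)
      rw [norm_neg]; exact hlp
  -- (E) rigidity: `G = u⁻¹ log_p` on the one-units
  have hmul : ∀ v w : ℚ_[p], ‖v - 1‖ ≤ (p : ℝ)⁻¹ → ‖w - 1‖ ≤ (p : ℝ)⁻¹ →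
      (G (v * w) - (C.u : ℚ_[p])⁻¹ * padicLog p (v * w)) =
        (G v - (C.u : ℚ_[p])⁻¹ * padicLog p v) + (G w - (C.u : ℚ_[p])⁻¹ * padicLog p w) := by
    intro v w hv hw
    have hp1 : (p : ℝ)⁻¹ < 1 := inv_lt_one_of_one_lt₀ (by exact_mod_cast hp.out.one_lt)
    rw [G_mul v w hv hw, padicLog_mul_holds p (hv0 (hv.trans_lt hp1)) (hv0 (hw.trans_lt hp1))]
    ring
  have hD := eq_zero_of_mul_hom_of_norm_le_sq (fun v => G v - (C.u : ℚ_[p])⁻¹ * padicLog p v) 2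
    hmul G_tan (norm_le_inv_of_norm_lt_one hυ1)
  -- (F) read `G υ`
  have hGυ : G υ = E.padicFormalLog (-(x : ℚ_[p]) / y) := by
    show E.padicFormalLog (E.formalParameter ((VariableChange.pointEquiv E C).symm (Pt υ))) = _
    rw [Pt_pos ⟨hυ1, hυne⟩, VariableChange.pointEquiv_symm_apply, VariableChange.pointInv_some,
      E.formalParameter_some]
    simp only [hX, hY, VariableChange.ofX_toX, VariableChange.ofY_toY]
  have hD' : G υ - (C.u : ℚ_[p])⁻¹ * padicLog p υ = 0 := hD
  rw [← hGυ]
  linear_combination hD'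

end Literature.NumberTheory.EllipticCurves.SteinWuthrich2013

end
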